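/-
Copyright (c) 2026 the pub-hodgecm-mathlib formalisation cell (harness21).  Prover seat hodgecm-mathlib-F0P3a-p07 (g13), 2026-09-02.  Road «S3-ram» seeding wave (LEAD T11-41∕T11-60; owner F0P3a-p06 (g15));
(α₂) organ A₂ (d-ii-b) «SELF-DUAL DATA» for the type-(2) G-side (architect A-p12 (g23); design memo `DESIGN-A2d-TypeTwoGSide.v1` §1 (SD)).
-/
import Literature.NumberTheory.Automorphic.UnitaryLatticeTreeBlockLineStableRoot   -- ★ p847252 (this seat): `pairing_single_{left,right}_of_block` (block form bookkeeping), ★ `dualLatt_eq_self_of_isSelfDualLattice`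
import HarnessLib

/-!
# The lattice graph of a hermitian space — the W-part and the line part of a SELF-DUAL lattice for a BLOCK form: `M ∩ W = (pr_W M)^∨`, `M ∩ Ke = (pr_e M)⁻¹`
# (Jacobowitz 1962 §4; Bruhat–Tits 1972 §10; Kottwitz 1986 §3)

Topic `NumberTheory/Automorphic`; namespace `Literature.NumberTheory.Automorphic.UnitaryLatticeTree`.  THEOREMS ONLY (no definition, no instance, no notation, no named fact,
no `sorry`); kernel lane `--supports stmt-HodgeConjecture-24833`; datum-free (`K` with `Valued K ℤᵐ⁰`, `σ` valuation-preserving).  Cell `pub/hodgecm-mathlib`, crux H413 =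
`stmt-HodgeConjecture-24833`; road «S3-ram» (count-neutral), (α₂) P-2-ram (architect A-p12 (g23)) organ A₂ (d) «type-(2) G-side counts», part **(d-ii-b)**; design memo
`F0/P3a/F0P3a-p07/g13/type2G/DESIGN-A2d-TypeTwoGSide.v1.F0P3ap07g13.md` §1 (SD).  Seat F0P3a-p07 (g13).  HONEST LABEL: HC_CM is proved only modulo the cell's 2 remaining
named inputs (hLiu418 24832, h413 24833) until rung 0 closes; nothing printed is asserted here (elementary lattice algebra over a valuation ring).

THE MATHEMATICS.  `V = K³ = W_i ⊕ Ke_i` with a form `H` BLOCK at `i` (`H_{li} = H_{il} = 0` for `l ≠ i`, `|H_{ii}| = 1`, `det H` a unit), `pr(x) = x − x_i e_i`.  For a SELF-DUAL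
`𝒪`-lattice `M` (`M^∨ = M`):
* **(SD-W)** for `w ∈ W_i`:  `w ∈ M ⟺ ∀ m ∈ M, |⟨pr m, w⟩_H| ≤ 1` — i.e. `M ∩ W_i` is the dual, INSIDE `(W_i, H|_{W_i})`, of the projection `pr_W(M)` (`e_i ⊥ W_i`, so
  `⟨m, w⟩ = ⟨pr m, w⟩`); in particular the cotype of `pr_W M ∕ M ∩ W_i` is self-dual («cyclic of length `2a`» in memo §1);
* **(SD-e)** for `c ∈ K`:  `c·e_i ∈ M ⟺ ∀ m ∈ M, |m_i|·|c| ≤ 1` — i.e. `M ∩ Ke_i = π^{a}𝒪e_i` exactly when `pr_e(M) = π^{−a}𝒪e_i` (`|H_{ii}| = 1`).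
Together with ★ p847270 (d-ii-a) TUBE CRITERION these parametrise the fixed self-dual lattices of a type-(2) `γ = γ_W ⊕ u` by their W-data `(M ∩ W ⊆ pr_W M)` (memo §1).
* `pairing_sub_single_left_of_block` (`⟨pr m, w⟩ = ⟨m, w⟩` for `w ∈ W_i`), `mem_iff_forall_pairing_proj_le_one_of_block` (SD-W), `single_mem_iff_forall_v_mul_le_one_of_block` (SD-e).

## References
* [Jacobowitz1962] R. Jacobowitz, *Hermitian forms over local fields*, Amer. J. Math. 84 (1962), §4 (dual lattices, modular components).
* [BruhatTits1972] F. Bruhat, J. Tits, *Groupes réductifs sur un corps local I*, Publ. Math. IHÉS 41 (1972), §10.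
* [Kottwitz1986] R. E. Kottwitz, *Base change for unit elements of Hecke algebras*, Compositio Math. 60 (1986), §3.
-/

set_option autoImplicit false

noncomputable section

open scoped Valued WithZero Matrix MatrixGroups

namespace Literature.NumberTheory.Automorphic.UnitaryLatticeTree

open Literature.NumberTheory.Automorphic Literature.NumberTheory.Automorphic.HermitianLattice

variable {K : Type*} [Field K] [Valued K ℤᵐ⁰]

omit [Valued K ℤᵐ⁰] in
/-- For a form BLOCK at `i` (row `i` zero off the diagonal) and `w ∈ W_i`: `⟨m − m_i e_i, w⟩_H = ⟨m, w⟩_H` (`e_i ⊥ W_i`). [cite: BruhatTits1972, §10] -/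
theorem pairing_sub_single_left_of_block {N : ℕ} (σ : K →+* K) (H : Matrix (Fin N) (Fin N) K) (i : Fin N) (hHrow : ∀ l, l ≠ i → H i l = 0)
    (m : Fin N → K) {w : Fin N → K} (hwi : w i = 0) :
    pairing σ H (m - Pi.single i (m i)) w = pairing σ H m w := by
  rw [map_sub, LinearMap.sub_apply, pairing_single_left_of_block σ H i hHrow, hwi, mul_zero, sub_zero]

/-- **(SD-W)** For a SELF-DUAL `M` (form `H` block at `i`, `det H` a unit) and `w ∈ W_i`: `w ∈ M ⟺ ∀ m ∈ M, |⟨pr m, w⟩_H| ≤ 1` — the `W`-part `M ∩ W_i` is the dual of the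
projection `pr_W(M)` inside `W_i`. [cite: Jacobowitz1962, §4] [cite: Kottwitz1986, §3] -/
theorem mem_iff_forall_pairing_proj_le_one_of_block {σ : K →+* K} (hvσ : ∀ a, Valued.v (σ a) = Valued.v a) {ϖ : K} {H : Matrix (Fin 3) (Fin 3) K} (i : Fin 3)
    (hHrow : ∀ l, l ≠ i → H i l = 0) (hHdet : IsUnit H.det)
    {M : Submodule 𝒪[K] (Fin 3 → K)} (hM : IsSelfDualLattice σ ϖ H M) {w : Fin 3 → K} (hwi : w i = 0) :
    w ∈ M ↔ ∀ m ∈ M, Valued.v (pairing σ H (m - Pi.single i (m i)) w) ≤ 1 := by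
  have hMd : M ≤ dualLatt σ H M := le_dualLatt_of_isVertexLattice hvσ hM
  constructor
  · intro hw m hm
    rw [pairing_sub_single_left_of_block σ H i hHrow m hwi]
    exact (mem_dualLatt σ _ M _).1 (hMd hw) m hm
  · intro h
    rw [← dualLatt_eq_self_of_isSelfDualLattice hvσ hHdet hM, mem_dualLatt]
    intro m hm
    rw [← pairing_sub_single_left_of_block σ H i hHrow m hwi]
    exact h m hm

/-- **(SD-e)** For a SELF-DUAL `M` (form `H` block at `i` with `|H_{ii}| = 1`, `det H` a unit) and `c ∈ K`: `c·e_i ∈ M ⟺ ∀ m ∈ M, |m_i|·|c| ≤ 1` — the line part `M ∩ Ke_i`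
is `π^a𝒪e_i` exactly when the line projection `pr_e(M)` is `π^{−a}𝒪` (memo §1: `k(M) = 2a`). [cite: Jacobowitz1962, §4] [cite: Kottwitz1986, §3] -/
theorem single_mem_iff_forall_v_mul_le_one_of_block {σ : K →+* K} (hvσ : ∀ a, Valued.v (σ a) = Valued.v a) {ϖ : K} {H : Matrix (Fin 3) (Fin 3) K} (i : Fin 3)
    (hHcol : ∀ l, l ≠ i → H l i = 0) (hhi : Valued.v (H i i) = 1) (hHdet : IsUnit H.det)
    {M : Submodule 𝒪[K] (Fin 3 → K)} (hM : IsSelfDualLattice σ ϖ H M) (c : K) :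
    (Pi.single i c : Fin 3 → K) ∈ M ↔ ∀ m ∈ M, Valued.v (m i) * Valued.v c ≤ 1 := by
  have hMd : M ≤ dualLatt σ H M := le_dualLatt_of_isVertexLattice hvσ hM
  have hkey : ∀ m : Fin 3 → K, Valued.v (pairing σ H m (Pi.single i c)) = Valued.v (m i) * Valued.v c := fun m => by
    rw [pairing_single_right_of_block σ H i hHcol, map_mul, map_mul, hvσ, hhi, mul_one]
  constructor
  · intro hc m hm
    rw [← hkey]
    exact (mem_dualLatt σ _ M _).1 (hMd hc) m hm
  · intro h
    rw [← dualLatt_eq_self_of_isSelfDualLattice hvσ hHdet hM, mem_dualLatt]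
    intro m hm
    rw [hkey]
    exact h m hm

end Literature.NumberTheory.Automorphic.UnitaryLatticeTree

end
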